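/-
Copyright (c) 2026 the pub-hodgecm-mathlib formalisation cell (harness21).  Prover seat hodgecm-mathlib-LH4-p08 (g7), req620 Track A «(D-RAM) FOUR-FRAME» squad, helper lane
on h413 = stmt-HodgeConjecture-24833 (count-neutral).  STAGE-1b typed inventory (heir LEAD F0P3a-plan (g20) T19-24): ROW (3) G-SIDE OF EVERY FROZEN PIECE, CLOSED FORM.  2026-09-04.
-/
import Summits.HodgeConjecture.HodgeConjecture.Theorems.F0P3cDyRamPieceLeviKappaSum             -- ★ p858934 (this seat): `exists_nhds_one_finsum_delta_gselStar_mul_integral_eq_of_levi`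
import Summits.HodgeConjecture.HodgeConjecture.Theorems.F0P3cDyRamAnchorLeviClause              -- ★ p855650 (LH4-p06 (g2)): (ρ3a) the anchor's row (3) `Σᶠ Δ‴·Φ(1_{K_t}) = (νG₃(K_t)∕νH(K_H))·Φ^st(hFamily 0)`
import Summits.HodgeConjecture.HodgeConjecture.Theorems.F0P3cDyRamPieceCountDictionaryUnit0     -- ★ (B-p08 (g41)): brings ★ `isSelfDualLattice_stdLattice_three_of_v`, ★ `mem_localIntegralLevel_iff_of_smul_eq`, ★ `mapGL_stdLattice_eq_iff_mem_glInt` (root anchor `𝒪_w³ ∕ K`)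
import HarnessLib

/-!
# Crux `H413`, line LH4 «(D-RAM) FOUR-FRAME» — ROW (3) `G`-SIDE OF EVERY FROZEN PIECE IN CLOSED FORM: near `1` on the Levi population
# `(Σᶠ_c Δ‴_v[μ](γ_H, c)·Φ(c, gselStar j)) · μ_N(N ∩ K) = (νG₃(K)∕νH(K_H)) · Φ^st(γ_H, hFamily 0) · ∫_N gselStar j dμ_N`

Cell `hodgecm-mathlib` (D-0151), FLOOR 0, crux item H413 = `stmt-HodgeConjecture-24833`, route of record `HCCMUnconditional`; squad F0∕P3c∕LH4 (req618∕req620); helper lane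
`--supports stmt-HodgeConjecture-24833 --as helper` (count-neutral).  THEOREMS ONLY (no `def`, no instance, no notation, no `sorry`, default heartbeats).

WHAT.  ROW (3) of `PieceRowsWild gselStar j` (tier-0 @92∕96∕100) asks, near `1 ∈ H_v` on the LEVI population, for `Σᶠ_c Δ‴_v[μ](γ_H, out c)·Φ(c, gselStar j) = Σ_s a_s Φ^st(γ_H, ψ_s)`.
Its `G`-SIDE is now a closed form: ★ p858934 (the pieces are proportional to the anchor in the ratio of their unipotent-fibre volumes, any transfer factor) at `j′ = 0`
(`gselStar 0 = pieceUnit0 = 1_K`, `∫_N 1_K = μ_N{n ∈ N | n ∈ K}`, §1) combined with ★ p855650 (the anchor's row (3) at the root vertex `𝒪_w³`, `K_t = K`) gives, for the transfer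
factor OF RECORD `Δ‴_v[μ]` and the canonical families of the row:
`(Σᶠ_c Δ‴(γ_H, out c)·Φ(c, gselStar j)) · μ_N{n ∈ N | n ∈ K} = (νG₃(K)∕νH(K_H)) · Φ^st(γ_H, hFamily 0) · ∫_N gselStar j dμ_N` — division-free on the piece side (the
possibly-vanishing fibre volume `∫_N gselStar j` is never inverted; `μ_N{n ∈ K} > 0` is the consumer's one-line normalisation if it wants to divide).
So ROW (3) of `f_{T+}, f_{T−}, f_reg` with `ψ := hFamily`, coefficients `a`, is EXACTLY the scalar identity `(a_0 ν_0 + a_1 ν_1)·μ_N{n ∈ K} = (νG₃(K)∕νH(K_H))·ν_0·∫_N gselStar j`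
(★ (ρ3a′) `hProfiles_levi_ratio_wild` makes every `Φ^st(hFamily s)` a multiple of `Φ^st(hFamily 0)` there) — one unipotent-fibre volume per piece, nothing else (PRESCOPE v3 §7∕§8).

* `integral_gselStar_zero_eq_measureReal` — `∫_N gselStar 0 = μ_N{n | n ∈ K}` (the anchor's fibre volume).
* `exists_nhds_one_finsum_delta_gselStar_mul_measureReal_eq_of_levi` — the closed form above.
HONEST LABEL.  Count-neutral (`--supports`): composition BY NAME over ★ only; pays no registered stub and touches no `Lines/` module; the three tier-0 rows stay OPEN;
`HC_CM` is proved only modulo the 7 printed citations (2 remaining named inputs: hLiu418 = `stmt-HodgeConjecture-24832`, h413 = `stmt-HodgeConjecture-24833`) until rung 0 closes.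

## References
* [Rogawski1990] J. D. Rogawski, *Automorphic Representations of Unitary Groups in Three Variables*, Ann. of Math. Stud. 123 (1990): §4.9 Prop. 4.9.1 (b) p. 55, Lemma 4.9.2
  p. 56; §4.3 (4.3.1) p. 43; §3.5 Prop. 3.5.2 pp. 25–26.
* [Kottwitz1986] R. E. Kottwitz, *Base change for unit elements of Hecke algebras*, Compositio Math. 60 (1986): §7.
* [BruhatTits1972] F. Bruhat, J. Tits, *Groupes réductifs sur un corps local I*, Publ. Math. IHÉS 41 (1972), §10.
-/

set_option autoImplicit false

noncomputable section

namespace Summit.HodgeConjecture.HodgeConjecture.Cruxes.H413.F0P3cDyRamPieceLeviRow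

open MeasureTheory Measure NumberField IsDedekindDomain Topology Filter
open Literature.NumberTheory.Automorphic Literature.NumberTheory.Automorphic.UnitaryGroup Literature.NumberTheory.Automorphic.IntegralReduction
open Literature.NumberTheory.Automorphic.UnitaryLatticeTree Literature.NumberTheory.Automorphic.HermitianLattice
open Literature.NumberTheory.Rogawski1990 Literature.NumberTheory.GaloisRepresentations
open scoped Matrix MatrixGroups Classical ValuativeRel WithZero
open Summit.HodgeConjecture.HodgeConjecture.Cruxes.H413.F0P3cDyRamFourFramePieces
open Summit.HodgeConjecture.HodgeConjecture.Cruxes.H413.F0P3cDyRamFourFrameHFamilyDefs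
open Summit.HodgeConjecture.HodgeConjecture.Cruxes.H413.F0P3cDyRamPieceLeviKappaSum
open Summit.HodgeConjecture.HodgeConjecture.Cruxes.H413.F0P3cDyRamAnchorLeviClause

/-! ## §1  The anchor's unipotent-fibre volume -/

/-- **`∫_N gselStar 0 dμ_N = μ_N{n ∈ N | n ∈ K}`** — `gselStar 0 = pieceUnit0 = 1_K` (`rfl`), and `{n | n ∈ K}` is open in `N` (so Borel-measurable) because `K` is open.
[cite: Rogawski1990, §4.9 p. 54] [cite: BruhatTits1972, §10] -/
theorem integral_gselStar_zero_eq_measureReal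
    (L : Type) [Field L] [NumberField L] [IsCMField L]
    {v : HeightOneSpectrum (𝓞 ↥(maximalRealSubfield L))} (w : UnitaryGroup.PlacesOver L v)
    (hw : IsCMField.complexConj L • w.1 = w.1) (ϖ : (w.1.adicCompletion L))
    [MeasurableSpace ↥(unitaryGroupOfForm (conjLocal L (IsCMField.complexConj L) v) (cmLocalForm L 3 v))] [BorelSpace ↥(unitaryGroupOfForm (conjLocal L (IsCMField.complexConj L) v) (cmLocalForm L 3 v))]
    (μN : Measure ↥(unipotentU (conjLocal L (IsCMField.complexConj L) v) (cmLocalForm L 3 v))) :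
    ∫ n : ↥(unipotentU (conjLocal L (IsCMField.complexConj L) v) (cmLocalForm L 3 v)), (gselStar 0) L v w hw ϖ ((n : ↥(unitaryGroupOfForm (conjLocal L (IsCMField.complexConj L) v) (cmLocalForm L 3 v))) : ((cmDatum L 3 (Matrix.of fun i j : Fin 3 => if i.val + j.val + 1 = 3 then (1 : L) else 0)).Local v)) ∂μN =
      ((μN.real {n : ↥(unipotentU (conjLocal L (IsCMField.complexConj L) v) (cmLocalForm L 3 v)) | ((n : ↥(unitaryGroupOfForm (conjLocal L (IsCMField.complexConj L) v) (cmLocalForm L 3 v))) : ((cmDatum L 3 (Matrix.of fun i j : Fin 3 => if i.val + j.val + 1 = 3 then (1 : L) else 0)).Local v)) ∈ cmLocalIntegralLevel L 3 (Matrix.of fun i j : Fin 3 => if i.val + j.val + 1 = 3 then (1 : L) else 0) v} : ℝ) : ℂ) := by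
  -- the level as a subgroup of the `unitaryGroupOfForm` spelling (open), and the measurability of its trace on `N`
  obtain ⟨K3, hK3⟩ : ∃ K3 : Subgroup ↥(unitaryGroupOfForm (conjLocal L (IsCMField.complexConj L) v) (cmLocalForm L 3 v)), K3 = cmLocalIntegralLevel L 3 (Matrix.of fun i j : Fin 3 => if i.val + j.val + 1 = 3 then (1 : L) else 0) v := ⟨_, rfl⟩
  have hK3o : IsOpen (K3 : Set ↥(unitaryGroupOfForm (conjLocal L (IsCMField.complexConj L) v) (cmLocalForm L 3 v))) := by
    rw [hK3]; exact (isCompact_isOpen_cmLocalIntegralLevel L 3 (Matrix.of fun i j : Fin 3 => if i.val + j.val + 1 = 3 then (1 : L) else 0) v).2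
  have hS : MeasurableSet {n : ↥(unipotentU (conjLocal L (IsCMField.complexConj L) v) (cmLocalForm L 3 v)) | ((n : ↥(unitaryGroupOfForm (conjLocal L (IsCMField.complexConj L) v) (cmLocalForm L 3 v))) : ((cmDatum L 3 (Matrix.of fun i j : Fin 3 => if i.val + j.val + 1 = 3 then (1 : L) else 0)).Local v)) ∈ cmLocalIntegralLevel L 3 (Matrix.of fun i j : Fin 3 => if i.val + j.val + 1 = 3 then (1 : L) else 0) v} := by
    have hSK : {n : ↥(unipotentU (conjLocal L (IsCMField.complexConj L) v) (cmLocalForm L 3 v)) | ((n : ↥(unitaryGroupOfForm (conjLocal L (IsCMField.complexConj L) v) (cmLocalForm L 3 v))) : ((cmDatum L 3 (Matrix.of fun i j : Fin 3 => if i.val + j.val + 1 = 3 then (1 : L) else 0)).Local v)) ∈ cmLocalIntegralLevel L 3 (Matrix.of fun i j : Fin 3 => if i.val + j.val + 1 = 3 then (1 : L) else 0) v} = Subtype.val ⁻¹' (K3 : Set ↥(unitaryGroupOfForm (conjLocal L (IsCMField.complexConj L) v) (cmLocalForm L 3 v))) := by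
      ext n; rw [hK3]; rfl
    rw [hSK]
    exact (hK3o.preimage continuous_subtype_val).measurableSet
  have hfun : (fun n : ↥(unipotentU (conjLocal L (IsCMField.complexConj L) v) (cmLocalForm L 3 v)) => (gselStar 0) L v w hw ϖ ((n : ↥(unitaryGroupOfForm (conjLocal L (IsCMField.complexConj L) v) (cmLocalForm L 3 v))) : ((cmDatum L 3 (Matrix.of fun i j : Fin 3 => if i.val + j.val + 1 = 3 then (1 : L) else 0)).Local v))) = Set.indicator {n : ↥(unipotentU (conjLocal L (IsCMField.complexConj L) v) (cmLocalForm L 3 v)) | ((n : ↥(unitaryGroupOfForm (conjLocal L (IsCMField.complexConj L) v) (cmLocalForm L 3 v))) : ((cmDatum L 3 (Matrix.of fun i j : Fin 3 => if i.val + j.val + 1 = 3 then (1 : L) else 0)).Local v)) ∈ cmLocalIntegralLevel L 3 (Matrix.of fun i j : Fin 3 => if i.val + j.val + 1 = 3 then (1 : L) else 0) v} (fun _ => (1 : ℂ)) := by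
    funext n
    show Set.indicator (cmLocalIntegralLevel L 3 (Matrix.of fun i j : Fin 3 => if i.val + j.val + 1 = 3 then (1 : L) else 0) v : Set ((cmDatum L 3 (Matrix.of fun i j : Fin 3 => if i.val + j.val + 1 = 3 then (1 : L) else 0)).Local v)) (fun _ => (1 : ℂ)) ((n : ↥(unitaryGroupOfForm (conjLocal L (IsCMField.complexConj L) v) (cmLocalForm L 3 v))) : ((cmDatum L 3 (Matrix.of fun i j : Fin 3 => if i.val + j.val + 1 = 3 then (1 : L) else 0)).Local v)) = _
    by_cases hn : ((n : ↥(unitaryGroupOfForm (conjLocal L (IsCMField.complexConj L) v) (cmLocalForm L 3 v))) : ((cmDatum L 3 (Matrix.of fun i j : Fin 3 => if i.val + j.val + 1 = 3 then (1 : L) else 0)).Local v)) ∈ cmLocalIntegralLevel L 3 (Matrix.of fun i j : Fin 3 => if i.val + j.val + 1 = 3 then (1 : L) else 0) v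
    · exact (Set.indicator_of_mem (show ((n : ↥(unitaryGroupOfForm (conjLocal L (IsCMField.complexConj L) v) (cmLocalForm L 3 v))) : ((cmDatum L 3 (Matrix.of fun i j : Fin 3 => if i.val + j.val + 1 = 3 then (1 : L) else 0)).Local v)) ∈ (cmLocalIntegralLevel L 3 (Matrix.of fun i j : Fin 3 => if i.val + j.val + 1 = 3 then (1 : L) else 0) v : Set ((cmDatum L 3 (Matrix.of fun i j : Fin 3 => if i.val + j.val + 1 = 3 then (1 : L) else 0)).Local v)) from hn) (fun _ => (1 : ℂ))).trans
        (Set.indicator_of_mem (show n ∈ {n : ↥(unipotentU (conjLocal L (IsCMField.complexConj L) v) (cmLocalForm L 3 v)) | ((n : ↥(unitaryGroupOfForm (conjLocal L (IsCMField.complexConj L) v) (cmLocalForm L 3 v))) : ((cmDatum L 3 (Matrix.of fun i j : Fin 3 => if i.val + j.val + 1 = 3 then (1 : L) else 0)).Local v)) ∈ cmLocalIntegralLevel L 3 (Matrix.of fun i j : Fin 3 => if i.val + j.val + 1 = 3 then (1 : L) else 0) v} from hn) (fun _ => (1 : ℂ))).symm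
    · exact (Set.indicator_of_notMem (show ((n : ↥(unitaryGroupOfForm (conjLocal L (IsCMField.complexConj L) v) (cmLocalForm L 3 v))) : ((cmDatum L 3 (Matrix.of fun i j : Fin 3 => if i.val + j.val + 1 = 3 then (1 : L) else 0)).Local v)) ∉ (cmLocalIntegralLevel L 3 (Matrix.of fun i j : Fin 3 => if i.val + j.val + 1 = 3 then (1 : L) else 0) v : Set ((cmDatum L 3 (Matrix.of fun i j : Fin 3 => if i.val + j.val + 1 = 3 then (1 : L) else 0)).Local v)) from hn) (fun _ => (1 : ℂ))).trans
        (Set.indicator_of_notMem (show n ∉ {n : ↥(unipotentU (conjLocal L (IsCMField.complexConj L) v) (cmLocalForm L 3 v)) | ((n : ↥(unitaryGroupOfForm (conjLocal L (IsCMField.complexConj L) v) (cmLocalForm L 3 v))) : ((cmDatum L 3 (Matrix.of fun i j : Fin 3 => if i.val + j.val + 1 = 3 then (1 : L) else 0)).Local v)) ∈ cmLocalIntegralLevel L 3 (Matrix.of fun i j : Fin 3 => if i.val + j.val + 1 = 3 then (1 : L) else 0) v} from hn) (fun _ => (1 : ℂ))).symm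
  rw [hfun, integral_indicator_const _ hS, Complex.real_smul, mul_one]

/-! ## §2  ROW (3)'s `G`-side for every frozen piece, closed form -/

/-- **ROW (3) `G`-SIDE OF `gselStar j` IN CLOSED FORM.**  At a wild ramified non-split CM place, for the transfer factor of record `Δ‴_v[μ]` (`μ|_{𝕀_{L⁺}} = ω`), canonical families
`mH`, `mG₃` for ANY Haar `νH`, `νG₃`, ANY s-finite Haar `μ_N` on `N(L⁺_v)` and every `j : Fin 4`: there is `V ∈ 𝓝 (1 : H_v)` such that for every `G`-regular `γ_H ∈ V` which is
`H_v`-conjugate to a diagonal, `(Σᶠ_c Δ‴(γ_H, out c)·Φ(c, gselStar j))·μ_N{n | n ∈ K} = (νG₃(K)∕νH(K_H))·Φ^st(γ_H, hFamily 0)·∫_N gselStar j dμ_N`.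
★ p858934 at `j′ = 0` ∘ §1 ∘ ★ p855650 at the root vertex (`N := 𝒪_w³`, `K_t := K`: ★ `isSelfDualLattice_stdLattice_three_of_v`, ★ `mem_localIntegralLevel_iff_of_smul_eq`, ★
`mapGL_stdLattice_eq_iff_mem_glInt`). [cite: Rogawski1990, §4.9 Prop. 4.9.1 (b) p. 55, Lemma 4.9.2 p. 56; §4.3 (4.3.1) p. 43; §3.5 Prop. 3.5.2 pp. 25–26] [cite: Kottwitz1986, §7] -/
theorem exists_nhds_one_finsum_delta_gselStar_mul_measureReal_eq_of_levi
    (L : Type) [Field L] [NumberField L] [IsCMField L]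
    {v : HeightOneSpectrum (𝓞 ↥(maximalRealSubfield L))} (w : UnitaryGroup.PlacesOver L v)
    (hw : IsCMField.complexConj L • w.1 = w.1)
    (he : v.asIdeal.ramificationIdx' w.1.asIdeal ≠ 1)
    (h2 : ¬ IsUnit (2 : 𝒪[w.1.adicCompletion L]))
    (ϖ : w.1.adicCompletion L) (hϖ : Valued.v ϖ = WithZero.exp (-1 : ℤ))
    (μ : HeckeCharacter L)
    (hμω : ∀ x : ideleGroup ↥(maximalRealSubfield L), μ (AdeleRing.ideleBaseChange ↥(maximalRealSubfield L) L x) = quadraticHeckeCharCM L x)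
    [MeasurableSpace ((cmDatum L 3 (Matrix.of fun i j : Fin 3 => if i.val + j.val + 1 = 3 then (1 : L) else 0)).Local v)]
    [BorelSpace ((cmDatum L 3 (Matrix.of fun i j : Fin 3 => if i.val + j.val + 1 = 3 then (1 : L) else 0)).Local v)]
    [∀ γ : ((cmDatum L 3 (Matrix.of fun i j : Fin 3 => if i.val + j.val + 1 = 3 then (1 : L) else 0)).Local v),
      MeasurableSpace (((cmDatum L 3 (Matrix.of fun i j : Fin 3 => if i.val + j.val + 1 = 3 then (1 : L) else 0)).Local v) ⧸
        Subgroup.centralizer ({γ} : Set ((cmDatum L 3 (Matrix.of fun i j : Fin 3 => if i.val + j.val + 1 = 3 then (1 : L) else 0)).Local v)))]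
    [∀ γ : ((cmDatum L 3 (Matrix.of fun i j : Fin 3 => if i.val + j.val + 1 = 3 then (1 : L) else 0)).Local v),
      BorelSpace (((cmDatum L 3 (Matrix.of fun i j : Fin 3 => if i.val + j.val + 1 = 3 then (1 : L) else 0)).Local v) ⧸
        Subgroup.centralizer ({γ} : Set ((cmDatum L 3 (Matrix.of fun i j : Fin 3 => if i.val + j.val + 1 = 3 then (1 : L) else 0)).Local v)))]
    [MeasurableSpace ((cmDatum L 2 (Matrix.of fun i j : Fin 2 => if i.val + j.val + 1 = 2 then (1 : L) else 0)).Local v ×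
      (cmDatum L 1 (Matrix.of fun i j : Fin 1 => if i.val + j.val + 1 = 1 then (1 : L) else 0)).Local v)]
    [BorelSpace ((cmDatum L 2 (Matrix.of fun i j : Fin 2 => if i.val + j.val + 1 = 2 then (1 : L) else 0)).Local v ×
      (cmDatum L 1 (Matrix.of fun i j : Fin 1 => if i.val + j.val + 1 = 1 then (1 : L) else 0)).Local v)]
    [∀ a : ((cmDatum L 2 (Matrix.of fun i j : Fin 2 => if i.val + j.val + 1 = 2 then (1 : L) else 0)).Local v ×
      (cmDatum L 1 (Matrix.of fun i j : Fin 1 => if i.val + j.val + 1 = 1 then (1 : L) else 0)).Local v),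
      MeasurableSpace (((cmDatum L 2 (Matrix.of fun i j : Fin 2 => if i.val + j.val + 1 = 2 then (1 : L) else 0)).Local v ×
      (cmDatum L 1 (Matrix.of fun i j : Fin 1 => if i.val + j.val + 1 = 1 then (1 : L) else 0)).Local v) ⧸ Subgroup.centralizer ({a} : Set ((cmDatum L 2 (Matrix.of fun i j : Fin 2 => if i.val + j.val + 1 = 2 then (1 : L) else 0)).Local v ×
      (cmDatum L 1 (Matrix.of fun i j : Fin 1 => if i.val + j.val + 1 = 1 then (1 : L) else 0)).Local v)))]
    [∀ a : ((cmDatum L 2 (Matrix.of fun i j : Fin 2 => if i.val + j.val + 1 = 2 then (1 : L) else 0)).Local v ×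
      (cmDatum L 1 (Matrix.of fun i j : Fin 1 => if i.val + j.val + 1 = 1 then (1 : L) else 0)).Local v),
      BorelSpace (((cmDatum L 2 (Matrix.of fun i j : Fin 2 => if i.val + j.val + 1 = 2 then (1 : L) else 0)).Local v ×
      (cmDatum L 1 (Matrix.of fun i j : Fin 1 => if i.val + j.val + 1 = 1 then (1 : L) else 0)).Local v) ⧸ Subgroup.centralizer ({a} : Set ((cmDatum L 2 (Matrix.of fun i j : Fin 2 => if i.val + j.val + 1 = 2 then (1 : L) else 0)).Local v ×
      (cmDatum L 1 (Matrix.of fun i j : Fin 1 => if i.val + j.val + 1 = 1 then (1 : L) else 0)).Local v)))]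
    (νH : Measure ((cmDatum L 2 (Matrix.of fun i j : Fin 2 => if i.val + j.val + 1 = 2 then (1 : L) else 0)).Local v ×
      (cmDatum L 1 (Matrix.of fun i j : Fin 1 => if i.val + j.val + 1 = 1 then (1 : L) else 0)).Local v)) [νH.IsHaarMeasure] [νH.IsMulRightInvariant]
    (νG₃ : Measure ((cmDatum L 3 (Matrix.of fun i j : Fin 3 => if i.val + j.val + 1 = 3 then (1 : L) else 0)).Local v)) [νG₃.IsHaarMeasure] [νG₃.IsMulRightInvariant]
    {mH : OrbitalMeasureFamily ((cmDatum L 2 (Matrix.of fun i j : Fin 2 => if i.val + j.val + 1 = 2 then (1 : L) else 0)).Local v ×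
      (cmDatum L 1 (Matrix.of fun i j : Fin 1 => if i.val + j.val + 1 = 1 then (1 : L) else 0)).Local v)}
    {mG₃ : OrbitalMeasureFamily ((cmDatum L 3 (Matrix.of fun i j : Fin 3 => if i.val + j.val + 1 = 3 then (1 : L) else 0)).Local v)}
    (hmH : mH.IsCanonical (IsLocalGRegular L v) νH)
    (hmG : mG₃.IsCanonical (fun γ => IsRegularElt (γ.val : GL (Fin 3) (UnitaryGroup.LocalRing L v))) νG₃)
    [MeasurableSpace ↥(unitaryGroupOfForm (conjLocal L (IsCMField.complexConj L) v) (cmLocalForm L 3 v))] [BorelSpace ↥(unitaryGroupOfForm (conjLocal L (IsCMField.complexConj L) v) (cmLocalForm L 3 v))]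
    (μN : Measure ↥(unipotentU (conjLocal L (IsCMField.complexConj L) v) (cmLocalForm L 3 v))) [μN.IsHaarMeasure] [SFinite μN] (j : Fin 4) :
    ∃ V ∈ 𝓝 (1 : ((cmDatum L 2 (Matrix.of fun i j : Fin 2 => if i.val + j.val + 1 = 2 then (1 : L) else 0)).Local v ×
        (cmDatum L 1 (Matrix.of fun i j : Fin 1 => if i.val + j.val + 1 = 1 then (1 : L) else 0)).Local v)),
      ∀ γH ∈ V, IsLocalGRegular L v γH →
        (∃ (y : ((cmDatum L 2 (Matrix.of fun i j : Fin 2 => if i.val + j.val + 1 = 2 then (1 : L) else 0)).Local v ×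
            (cmDatum L 1 (Matrix.of fun i j : Fin 1 => if i.val + j.val + 1 = 1 then (1 : L) else 0)).Local v)) (d' : Fin 2 → (UnitaryGroup.LocalRing L v)ˣ),
            glDiagonal 2 (UnitaryGroup.LocalRing L v) d' = ((y * γH * y⁻¹).1.val : GL (Fin 2) (UnitaryGroup.LocalRing L v))) →
        (∑ᶠ c : ConjClasses ((cmDatum L 3 (Matrix.of fun i j : Fin 3 => if i.val + j.val + 1 = 3 then (1 : L) else 0)).Local v),
            ((finExplicitCollection L (Matrix.of fun i j : Fin 3 => if i.val + j.val + 1 = 3 then (1 : L) else 0) μ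
              (finExplicitDelta_conj_left_all L (Matrix.of fun i j : Fin 3 => if i.val + j.val + 1 = 3 then (1 : L) else 0) μ)
              (finExplicitDelta_conj_right_all L (Matrix.of fun i j : Fin 3 => if i.val + j.val + 1 = 3 then (1 : L) else 0) μ)) v).Δ γH (Quotient.out c) *
            classOrbitalIntegral mG₃ ((gselStar j) L v w hw ϖ) c) *
            ((μN.real {n : ↥(unipotentU (conjLocal L (IsCMField.complexConj L) v) (cmLocalForm L 3 v)) | ((n : ↥(unitaryGroupOfForm (conjLocal L (IsCMField.complexConj L) v) (cmLocalForm L 3 v))) : ((cmDatum L 3 (Matrix.of fun i j : Fin 3 => if i.val + j.val + 1 = 3 then (1 : L) else 0)).Local v)) ∈ cmLocalIntegralLevel L 3 (Matrix.of fun i j : Fin 3 => if i.val + j.val + 1 = 3 then (1 : L) else 0) v} : ℝ) : ℂ) =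
          ((νG₃.real (cmLocalIntegralLevel L 3 (Matrix.of fun i j : Fin 3 => if i.val + j.val + 1 = 3 then (1 : L) else 0) v : Set ((cmDatum L 3 (Matrix.of fun i j : Fin 3 => if i.val + j.val + 1 = 3 then (1 : L) else 0)).Local v)) : ℂ) /
            (νH.real ((((cmLocalIntegralLevel L 2 (Matrix.of fun i j : Fin 2 => if i.val + j.val + 1 = 2 then (1 : L) else 0) v).prod
              (cmLocalIntegralLevel L 1 (Matrix.of fun i j : Fin 1 => if i.val + j.val + 1 = 1 then (1 : L) else 0) v) : Subgroup _) : Set _)) : ℂ)) *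
          stableOrbitalIntegralRel (IsLocalStablyConjH L v) mH (hFamily L w hw ϖ 0) γH *
          ∫ n : ↥(unipotentU (conjLocal L (IsCMField.complexConj L) v) (cmLocalForm L 3 v)), (gselStar j) L v w hw ϖ ((n : ↥(unitaryGroupOfForm (conjLocal L (IsCMField.complexConj L) v) (cmLocalForm L 3 v))) : ((cmDatum L 3 (Matrix.of fun i j : Fin 3 => if i.val + j.val + 1 = 3 then (1 : L) else 0)).Local v)) ∂μN := by
  -- the root anchor: `𝒪_w³` is a type-0 vertex and `K` is its stabiliser under `ι_w`
  have hN : IsVertexLattice (galAdicCompletionMap (L := L) (IsCMField.complexConj L) hw) ϖ ((StdForm.antidiagonal 3).over (w.1.adicCompletion L)) 0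
      (stdLattice (w.1.adicCompletion L) 3) :=
    isSelfDualLattice_stdLattice_three_of_v hϖ
  have hKt : ∀ u : ((cmDatum L 3 (Matrix.of fun i j : Fin 3 => if i.val + j.val + 1 = 3 then (1 : L) else 0)).Local v),
      u ∈ cmLocalIntegralLevel L 3 (Matrix.of fun i j : Fin 3 => if i.val + j.val + 1 = 3 then (1 : L) else 0) v ↔
        mapGL ((localNonsplitEquiv (IsCMField.complexConj L) (Matrix.of fun i j : Fin 3 => if i.val + j.val + 1 = 3 then (1 : L) else 0) (IsCMField.complexConj_ne_one L) w hw u :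
          ↥(unitaryGroupOfForm (galAdicCompletionMap (L := L) (IsCMField.complexConj L) hw) (placeForm (Matrix.of fun i j : Fin 3 => if i.val + j.val + 1 = 3 then (1 : L) else 0) w.1))) : GL (Fin 3) (w.1.adicCompletion L))
          (stdLattice (w.1.adicCompletion L) 3) = stdLattice (w.1.adicCompletion L) 3 :=
    fun u => (mem_localIntegralLevel_iff_of_smul_eq (IsCMField.complexConj L) 3 (Matrix.of fun i j : Fin 3 => if i.val + j.val + 1 = 3 then (1 : L) else 0) (IsCMField.complexConj_ne_one L) w hw u).trans
      (mapGL_stdLattice_eq_iff_mem_glInt _).symm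
  -- the anchor's row (3) at `K_t = K` and the proportionality at `j′ = 0`
  obtain ⟨V₀, hV₀, h0⟩ := exists_nhds_one_finsum_delta_indicator_eq_mul_stableOrbitalIntegralRel_hFamily_zero_of_levi L w hw he ϖ hϖ μ hμω νH νG₃ hmH hmG hN
    (cmLocalIntegralLevel L 3 (Matrix.of fun i j : Fin 3 => if i.val + j.val + 1 = 3 then (1 : L) else 0) v) hKt
  obtain ⟨V₁, hV₁, h1⟩ := exists_nhds_one_finsum_delta_gselStar_mul_integral_eq_of_levi L w hw he h2 ϖ hϖ νG₃ hmG μN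
    ((finExplicitCollection L (Matrix.of fun i j : Fin 3 => if i.val + j.val + 1 = 3 then (1 : L) else 0) μ (finExplicitDelta_conj_left_all L (Matrix.of fun i j : Fin 3 => if i.val + j.val + 1 = 3 then (1 : L) else 0) μ) (finExplicitDelta_conj_right_all L (Matrix.of fun i j : Fin 3 => if i.val + j.val + 1 = 3 then (1 : L) else 0) μ)) v) j 0
  refine ⟨V₀ ∩ V₁, inter_mem hV₀ hV₁, fun γH hγ hreg hlevi => ?_⟩
  have e0 := h0 γH hγ.1 hreg hlevi
  have e1 := h1 γH hγ.2 hlevi hreg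
  have hg0 : (gselStar 0) L v w hw ϖ = Set.indicator (cmLocalIntegralLevel L 3 (Matrix.of fun i j : Fin 3 => if i.val + j.val + 1 = 3 then (1 : L) else 0) v : Set ((cmDatum L 3 (Matrix.of fun i j : Fin 3 => if i.val + j.val + 1 = 3 then (1 : L) else 0)).Local v)) (fun _ => (1 : ℂ)) := rfl
  rw [integral_gselStar_zero_eq_measureReal L w hw ϖ μN, hg0] at e1
  rw [e1, e0]

end Summit.HodgeConjecture.HodgeConjecture.Cruxes.H413.F0P3cDyRamPieceLeviRow

end
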